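import Literature.Computability.QuantumComplexity.CoreDescBlockFP
import HarnessLib

/-!
# The AJL core circuit family is polynomial-time uniform

Topic `Literature/Computability/QuantumComplexity`; last step of the uniformity half of the discharge
of `ajl_jonesApproxProblem_mem_PromiseBQP`. Aharonov–Jones–Landau (Algorithmica 55 (2009), Thm. 1.2
and §3.3) state that Algorithm Approximate-Jones-Plat-Closure runs in time polynomial in `n, m, k`; in
the tree's model (`Cryptography.PromiseBQP`: oracle-free Clifford+T families printed from `1ⁿ` by a
polynomial-time machine, `QCircuitFamily.IsUniform`, after Bernstein–Vazirani and Arora–Barak §6.2)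
this is the statement **`AJLCore.family_isUniform : AJLCore.family.IsUniform`** proved here. From the
input length `ℓ` in unary we compute the block parameters (`pOf_fp`: `t = ⌊√(ℓ/16)⌋`, `n = 2t`,
`r = t`, `k = 2t + 60`, and the layout bounds `kitR/kitF/kitT k` of `CoreDescSLPCodes.lean`), the
abstract fan-out and copies stages (`stage1A_fp`, `stage2A_fp`, with the block of
`CoreDescBlockFP.lean` transported along `eblkVal`), hence the abstract gate list `circA ℓ`
(`circA_fp`) and, through `sigmaEncode_circ` (`CoreDescAbstract.lean`), the description
`sigmaEncode ⟨ℓ, anc ℓ, circ ℓ⟩` in the typed `FP` algebra `CodeFP`; `CodeFP.polyTimeComputable` turns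
this into the uniformity machine.

## References

* D. Aharonov, V. Jones, Z. Landau, Algorithmica 55 (2009), Thm. 1.2 and §3.3 [AharonovJonesLandau2009].
* E. Bernstein, U. Vazirani, SIAM J. Comput. 26 (1997), §8 (uniform quantum circuit families) [BernsteinVazirani1997].
* S. Arora, B. Barak, *Computational Complexity: A Modern Approach*, CUP 2009, §6.2 and proof of Thm. 6.15 [AroraBarak2009].
-/

noncomputable section

namespace Literature.Computability.QuantumComplexity

open _root_.Computability Cryptography Complexity Complexity.CodeFP SLP RevDesc BlockKit

namespace AJLCore

/-! ### The sizes from the input length -/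

/-- **`1^ℓ ↦ 1^t`**, `t = ⌊√(ℓ/16)⌋`. [folklore] -/
theorem tOf_fp : CodeFP unE unE tOf := by
  have ht : CodeFP unE natE tOf := ((natSqrt.comp (natDiv.comp (natOfUn.pair (const _ 16)))).congr fun _ => rfl :)
  exact (unOfNatMin.comp ((CodeFP.id _).pair ht)).congr fun ℓ => by
    show min (tOf ℓ) ℓ = tOf ℓ
    have h1 : tOf ℓ ≤ ℓ / 16 := Nat.sqrt_le_self _
    have h2 : ℓ / 16 ≤ ℓ := Nat.div_le_self _ _
    omega

/-- `1^ℓ ↦ 1^k`, `k = 2t + 60`. [folklore] -/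
theorem kOf_fp : CodeFP unE unE kOf := ((affUn 2 60).comp tOf_fp).congr fun _ => rfl

/-- **The block parameters from the input length.** [folklore] -/
theorem pOf_fp : CodeFP unE bpE pOf := by
  have h : CodeFP unE (pairE unE (pairE unE (pairE unE (pairE unE (pairE unE unE))))) (fun ℓ => (nOf ℓ, rOf ℓ, kOf ℓ, kitR (kOf ℓ), kitF (kOf ℓ), kitT (kOf ℓ))) :=
    ((((affUn 2 0).comp tOf_fp).congr fun _ => rfl).pair (tOf_fp.pair (kOf_fp.pair ((kitR_codeFP.comp kOf_fp).pair ((kitF_codeFP.comp kOf_fp).pair (kitT_codeFP.comp kOf_fp))))) :)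
  exact h.recodeOut fun _ => rfl

/-- `1^ℓ ↦ 1^K`, `K = 192 t²`. [folklore] -/
theorem KOf_u : CodeFP unE unE KOf := ((BP.umul (BP.uconst _ 192) (BP.umul tOf_fp tOf_fp)).congr fun ℓ => by show 192 * (tOf ℓ * tOf ℓ) = 192 * tOf ℓ ^ 2; ring :)

/-- `1^ℓ ↦ 1^m`, `m = 2K`. [folklore] -/
theorem mOf_u : CodeFP unE unE mOf := ((affUn 2 0).comp KOf_u).congr fun _ => by simp

/-- `1^ℓ ↦ 1^b`, the block size. [folklore] -/
theorem bOf_u : CodeFP unE unE bOf := (BP.b_u.comp pOf_fp).congr fun _ => rfl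

/-- `1^ℓ ↦ 1^{anc ℓ}`. [folklore] -/
theorem anc_u : CodeFP unE unE anc := (BP.umul mOf_u bOf_u).congr fun _ => rfl

/-! ### Transport along the block embeddings -/

/-- **The block-embedding values on codes**: `((ℓ, j), i) ↦ eblkVal ℓ j i`. [folklore] -/
theorem eblkVal_fp : CodeFP (pairE (pairE unE natE) natE) natE (fun t => eblkVal t.1.1 t.1.2 t.2) := by
  have hℓ : CodeFP (pairE (pairE unE natE) natE) natE (fun t => t.1.1) := BP.toNat (fst _ _).fst'
  have hj : CodeFP (pairE (pairE unE natE) natE) natE (fun t => t.1.2) := (fst _ _).snd'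
  have hi : CodeFP (pairE (pairE unE natE) natE) natE (fun t => t.2) := snd _ _
  have hm : CodeFP (pairE (pairE unE natE) natE) natE (fun t => mOf t.1.1) := BP.toNat (mOf_u.comp (fst _ _).fst')
  have hb : CodeFP (pairE (pairE unE natE) natE) natE (fun t => bOf t.1.1) := BP.toNat (bOf_u.comp (fst _ _).fst')
  have h1 : CodeFP (pairE (pairE unE natE) natE) natE (fun t => t.1.1 + t.1.2) := (natAdd.comp (hℓ.pair hj) :)
  have h2 : CodeFP (pairE (pairE unE natE) natE) natE (fun t => t.1.1 + mOf t.1.1 + t.1.2 * (bOf t.1.1 - 1) + (t.2 - 1)) :=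
    (natAdd.comp ((natAdd.comp ((natAdd.comp (hℓ.pair hm)).pair (natMul.comp (hj.pair (natSub.comp (hb.pair (const _ 1))))))).pair (natSub.comp (hi.pair (const _ 1)))) :)
  exact (iteProp (natEq.comp (hi.pair (const _ 0))) h1 h2).congr fun _ => rfl

/-- Transporting an abstract gate along a block embedding, on codes. [folklore] -/
theorem AGmap_fp : CodeFP (pairE (pairE unE natE) agE0) agE0 (fun t => AGmap (eblkVal t.1.1 t.1.2) t.2) := by
  have hT : CodeFP (pairE (pairE unE natE) agE0) ctE (fun t => agTuple t.2) := (transparent (eα := agE0) (eβ := ctE) (g := agTuple) fun _ => rfl).comp (snd _ _)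
  have hws : CodeFP (pairE (pairE unE natE) agE0) (rawE natE) (fun t => (agTuple t.2).2.map (eblkVal t.1.1 t.1.2)) :=
    ((map (σ := ℕ × ℕ) (α := ℕ) (g := fun q => eblkVal q.1.1 q.1.2 q.2) eblkVal_fp).comp ((fst _ _).pair hT.snd')).congr fun _ => rfl
  exact ag_of_tuple (hT.fst'.pair hws) fun _ => rfl

/-! ### The copies stage -/

/-- **The copies stage on codes.** [cite: AharonovJonesLandau2009, §3.3] -/
theorem stage2A_fp : CodeFP unE (rawE agE0) stage2A := by
  have hcopy : CodeFP (pairE unE natE) (rawE agE0) (fun t => (pOf t.1).copyA (decide (KOf t.1 ≤ t.2))) :=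
    (BP.copyA_fp.comp ((pOf_fp.comp (fst _ _)).pair (natLe.comp ((BP.toNat (KOf_u.comp (fst _ _))).pair (snd _ _)))) :)
  have hitem : CodeFP (pairE unE natE) (rawE agE0) (fun t => ((pOf t.1).copyA (decide (KOf t.1 ≤ t.2))).map (AGmap (eblkVal t.1 t.2))) :=
    ((map (σ := ℕ × ℕ) (α := AG) (g := fun q => AGmap (eblkVal q.1.1 q.1.2) q.2) AGmap_fp).comp ((CodeFP.id _).pair hcopy) :)
  have hrev : CodeFP unE (rawE natE) (fun ℓ => (List.range (mOf ℓ)).reverse) := ((rawReverse natE).comp (urange.comp mOf_u) :)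
  have h : CodeFP unE (rawE agE0) (fun ℓ => ((List.range (mOf ℓ)).reverse.map fun j => ((pOf ℓ).copyA (decide (KOf ℓ ≤ j))).map (AGmap (eblkVal ℓ j))).flatten) :=
    ((flatten agE0).comp ((map hitem).comp ((CodeFP.id _).pair hrev)) :)
  exact h.congr fun _ => rfl

/-! ### The fan-out stage -/

/-- The fan-out pairs into a block, on codes. [folklore] -/
theorem blockPairsA_fp : CodeFP (pairE unE natE) (rawE (pairE natE natE)) (fun t => blockPairsA t.1 t.2) := by
  -- contexts `(ℓ, j)`; the table part: slots `s`, then letters `ib`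
  let cE : (ℕ × ℕ) × ℕ → List Bool := pairE (pairE unE natE) natE
  have hP3 : CodeFP (pairE cE (pairE natE bitE)) bpE (fun q => pOf q.1.1.1) := pOf_fp.comp (fst _ _).fst'.fst'
  have hx : CodeFP (pairE cE (pairE natE bitE)) natE (fun q => 2 * q.2.1 + q.2.2.toNat) :=
    (natAdd.comp ((natMul.comp ((const _ 2).pair (snd _ _).fst')).pair (BravyiGosset.toNat_codeFP.comp (snd _ _).snd')) :)
  have hA3 : CodeFP (pairE cE (pairE natE bitE)) natE (fun q => A (nOf q.1.1.1)) := BP.toNat (BP.A_u.comp hP3)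
  have htab1 : CodeFP (pairE cE (pairE natE bitE)) natE (fun q => q.1.2 * A (nOf q.1.1.1) + (2 * q.2.1 + q.2.2.toNat)) :=
    (natAdd.comp ((natMul.comp ((fst _ _).snd'.pair hA3)).pair hx) :)
  have htw : CodeFP (pairE cE (pairE natE bitE)) natE (fun q => (pOf q.1.1.1).tw q.1.2 (2 * q.2.1 + q.2.2.toNat)) := BP.tw_fp hP3 (fst _ _).snd' hx
  have htab2 : CodeFP (pairE cE (pairE natE bitE)) natE (fun q => eblkVal q.1.1.1 q.1.1.2 ((pOf q.1.1.1).tw q.1.2 (2 * q.2.1 + q.2.2.toNat))) :=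
    (eblkVal_fp.comp ((fst _ _).fst'.pair htw) :)
  have htabItem : CodeFP (pairE cE (pairE natE bitE)) (pairE natE natE)
      (fun q => (q.1.2 * A (nOf q.1.1.1) + (2 * q.2.1 + q.2.2.toNat), eblkVal q.1.1.1 q.1.1.2 ((pOf q.1.1.1).tw q.1.2 (2 * q.2.1 + q.2.2.toNat)))) := htab1.pair htab2
  have hslot : CodeFP cE (rawE (pairE natE natE)) (fun c => (BP.lettersA (nOf c.1.1)).map fun ib =>
      (c.2 * A (nOf c.1.1) + (2 * ib.1 + ib.2.toNat), eblkVal c.1.1 c.1.2 ((pOf c.1.1).tw c.2 (2 * ib.1 + ib.2.toNat)))) :=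
    ((map htabItem).comp ((CodeFP.id _).pair ((BP.lettersA_fp.comp (pOf_fp.comp (fst _ _).fst')).congr fun _ => rfl)) :)
  have htab : CodeFP (pairE unE natE) (rawE (pairE natE natE)) (fun t => ((List.range (rOf t.1)).map fun s => (BP.lettersA (nOf t.1)).map fun ib =>
      (s * A (nOf t.1) + (2 * ib.1 + ib.2.toNat), eblkVal t.1 t.2 ((pOf t.1).tw s (2 * ib.1 + ib.2.toNat)))).flatten) :=
    ((flatten _).comp ((map hslot).comp ((CodeFP.id _).pair (urange.comp (tOf_fp.comp (fst _ _))))) :)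
  -- the pattern part
  have hr : CodeFP cE natE (fun c => rOf c.1.1 * A (nOf c.1.1)) := (natMul.comp ((BP.toNat (tOf_fp.comp (fst _ _).fst')).pair (BP.toNat (BP.A_u.comp (pOf_fp.comp (fst _ _).fst')))) :)
  have hpat1 : CodeFP cE natE (fun c => rOf c.1.1 * A (nOf c.1.1) + c.2) := (natAdd.comp (hr.pair (snd _ _)) :)
  have hpat2 : CodeFP cE natE (fun c => eblkVal c.1.1 c.1.2 ((pOf c.1.1).w (1 + c.2))) :=
    (eblkVal_fp.comp ((fst _ _).pair (BP.w_fp (pOf_fp.comp (fst _ _).fst') (natAdd.comp ((const _ 1).pair (snd _ _))))) :)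
  have hpat : CodeFP (pairE unE natE) (rawE (pairE natE natE)) (fun t => (List.range (2 * (nOf t.1 + 1))).map fun i => (rOf t.1 * A (nOf t.1) + i, eblkVal t.1 t.2 ((pOf t.1).w (1 + i)))) :=
    ((map (hpat1.pair hpat2)).comp ((CodeFP.id _).pair (urange.comp (((affUn 4 2).comp (tOf_fp.comp (fst _ _))).congr fun t => by show 4 * tOf t.1 + 2 = 2 * (2 * tOf t.1 + 1); ring))) :)
  exact ((rawAppend _).comp (htab.pair hpat)).congr fun t => by rw [blockPairsA, List.flatMap]

/-- The fan-out pairs, on codes. [folklore] -/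
theorem pairsA_fp : CodeFP unE (rawE (pairE natE natE)) pairsA := by
  have hfits : CodeFP unE bitE (fun ℓ => decide (Fits ℓ)) :=
    (natLe.comp ((natAdd.comp ((natMul.comp ((BP.toNat tOf_fp).pair (BP.toNat (BP.A_u.comp pOf_fp)))).pair (BP.toNat ((affUn 4 2).comp tOf_fp)))).pair natOfUn)).congr fun ℓ => by
      show decide (tOf ℓ * (pOf ℓ).A + (4 * tOf ℓ + 2) ≤ ℓ) = decide (Fits ℓ)
      unfold Fits rOf nOf; congr 1; simp only [show (pOf ℓ).A = A (2 * tOf ℓ) from rfl]; apply propext; constructor <;> intro h <;> omega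
  have hall : CodeFP unE (rawE (pairE natE natE)) (fun ℓ => ((List.range (mOf ℓ)).map (blockPairsA ℓ)).flatten) :=
    ((flatten _).comp ((map blockPairsA_fp).comp ((CodeFP.id _).pair (urange.comp mOf_u))) :)
  exact (iteProp hfits hall (const _ [])).congr fun ℓ => by rw [pairsA, List.flatMap]

/-- **The fan-out stage on codes.** [folklore] -/
theorem stage1A_fp : CodeFP unE (rawE agE0) stage1A := ((map₀ (ag_CX (fst _ _) (snd _ _))).comp pairsA_fp).congr fun _ => rfl

/-- **The abstract core circuit on codes.** [cite: AharonovJonesLandau2009, §3.3] -/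
theorem circA_fp : CodeFP unE (rawE agE0) circA := agAppend stage1A_fp stage2A_fp

/-! ### The description and uniformity -/

/-- From the working code to the code of a gate. [folklore] -/
theorem agE_of_agE0 : CodeFP agE0 agE id := by
  have hT : CodeFP agE0 ctE agTuple := transparent fun _ => rfl
  have h : CodeFP agE0 (pairE natE (listE natE)) (fun a => (symCode a.sym, a.wires)) := hT.fst'.pair ((listOfRaw natE).comp hT.snd')
  obtain ⟨f, hf, hfa⟩ := h
  exact ⟨List.cons false ∘ f, comp_mem_FP (cons_mem_FP false) hf, fun a => by rw [Function.comp_apply, hfa]; rfl⟩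

/-- **The description of the core circuit in polynomial time.** [cite: AroraBarak2009, §6.2] -/
theorem desc_codeFP : CodeFP unE (QCircuit.sigmaEncode (G := cliffordT)) (fun ℓ => (⟨ℓ, anc ℓ, circ ℓ⟩ : Σ n m : ℕ, QCircuit cliffordT (n + m))) := by
  have hc : CodeFP unE (rawE agE) circA := ((map₀ agE_of_agE0).comp circA_fp).congr fun _ => List.map_id _
  have h : CodeFP unE (pairE natE (pairE unE (rawE agE))) (fun ℓ => (ℓ, anc ℓ, circA ℓ)) := natOfUn.pair (anc_u.pair hc)
  exact h.recodeOut fun ℓ => by rw [sigmaEncode_circ]; rfl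

/-- **The AJL core circuit family is polynomial-time uniform.** [cite: AharonovJonesLandau2009, Thm. 1.2 and §3.3] -/
theorem family_isUniform : family.IsUniform := desc_codeFP.polyTimeComputable

end AJLCore

end Literature.Computability.QuantumComplexity

end
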